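import Literature.Computability.AlgebraicComplexity.BigCwSquareFormatValue112
import Summits.MatrixMultiplication.MatrixMultiplication.Theorems.SaturationLadderLevelOneEntropy

/-!
# Pooled level-1 designs — I: the first-power `CW_q` laser data in FORMAT currency (route `SaturationLadder`, lens 1, gen 20)

Cell `decomp-mm`, lens 1 («grading / quantitative ladder»), gen 20, part 5a.  No definitions, no
named facts, no sorry.  The POOLING THEOREM `laserMethod_hasFormatValue_pair_of_mul`
(`Literature/…/LaserFormatPooling.lean`: the laser method in format currency on `t ⊗ t'` with pair
labels — the count exponent is the minimum of the POOLED marginal entropies, Coppersmith 1997's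
mixed-`q` mechanism) consumes, per factor, exactly the laser data of `LaserFormatMethod.lean`.
This file supplies that data for the first power `CW_q = bigCwTensor K q` with its level partition
(`cwLevel₃`, support `cwSupport₃ = {i+j+l = 2}`, tightness `cwTight, cwTight, cwTightγ`):

* §1 `hasFormatValue_cwComp_six`: the six components have format values
  `(1; q^{ij}, q^{jl}, q^{il})` — `T₁₁₀ ≥ ⟨q,1,1⟩`, `T₀₁₁ ≥ ⟨1,q,1⟩`, `T₁₀₁ ≥ ⟨1,1,q⟩`, corners
  `⟨1,1,1⟩` (`BigCwSquareFormatValue112.hasFormatValue_cwComp…`);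
* §2 `prod_six_formatA/B/C`, `prod_six_one`: for a law `P` on the six patterns the weighted
  products are `Π fA^P = q^{P(1,1,0)}`, `Π fB^P = q^{P(0,1,1)}`, `Π fC^P = q^{P(1,0,1)}`, `Π 1^P = 1`;
* §3 `six_productForm`: every law POSITIVE on the six patterns is of product form
  `f(i)g(j)h(l)` there (`f = (1, √(p₁p₃/p₂), p₄)`, …), so pooled pairs of such laws have zero
  penalty (`maxEntropyPenalty_pairLaw_eq_zero_of_mul`);
* §4 `shannonEntropy_marginals_six_counts`: the marginal entropies of the law with counts
  `(n₁,…,n₆)/N₀` are the entropies of the count vectors `X = (n₂+n₅+n₆, n₁+n₃, n₄)`,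
  `Y = (n₃+n₄+n₆, n₁+n₂, n₅)`, `Z = (n₁+n₄+n₅, n₂+n₃, n₆)` over `N₀`, ready for
  `entropyCert_of_nat`.

Part 5b (`SaturationLadderPooledAlpha`) pools `CW_6 ⊗ CW_7` and reads `α ≥ 27/92`.

References: D. Coppersmith, *Rectangular matrix multiplication revisited*, J. Complexity 13 (1997)
§3 [Coppersmith1997]; Coppersmith–Winograd 1990 §6–7 [CoppersmithWinograd1990]; Le Gall 2014 §5,
App. A [LeGall2014].
-/

set_option linter.dupNamespace false
-- (single-conjunct summit: the namespace repeats `MatrixMultiplication`)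

noncomputable section

open Finset
open scoped BigOperators

namespace Summit.MatrixMultiplication.MatrixMultiplication.Theorems.SaturationLadderPooled

open Literature.Computability.AlgebraicComplexity
open Literature.Barriers.MatrixMultiplication
open Summit.MatrixMultiplication.MatrixMultiplication.Theorems.SaturationLadderLevelOne

universe u

/-! ## §1 Format values of the six level-1 components -/

section Formats

variable (K : Type u) [Field K] (q : ℕ)

/-- **The six components of `CW_q` have format values `(1; q^{ij}, q^{jl}, q^{il})`**:
`T₁₁₀ ≥ ⟨q,1,1⟩`, `T₀₁₁ ≥ ⟨1,q,1⟩`, `T₁₀₁ ≥ ⟨1,1,q⟩`, `T₂₀₀, T₀₂₀, T₀₀₂ ≥ ⟨1,1,1⟩`.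
[cite: CoppersmithWinograd1990, §7 eq. (10)] -/
theorem hasFormatValue_cwComp_six (s : Fin 3 × Fin 3 × Fin 3) (hs : s ∈ cwSupport₃) :
    HasFormatValue
      (partSubtensor cwLevel₃ cwLevel₃ cwLevel₃ (bigCwTensor K q) {s.1} {s.2.1} {s.2.2}) 1
      ((q : ℝ) ^ (s.1.val * s.2.1.val)) ((q : ℝ) ^ (s.2.1.val * s.2.2.val))
      ((q : ℝ) ^ (s.1.val * s.2.2.val)) := by
  rcases mem_cwSupport₃_iff.1 hs with rfl | rfl | rfl | rfl | rfl | rfl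
  · simpa using hasFormatValue_cwComp011 K q
  · simpa using hasFormatValue_cwComp101 K q
  · simpa using hasFormatValue_cwComp110 K q
  · simpa using hasFormatValue_cwComp200 K q
  · simpa using hasFormatValue_cwComp020 K q
  · simpa using hasFormatValue_cwComp002 K q

/-- The formats are positive (`q ≥ 1`). [folklore] -/
theorem format_six_pos (hq : 1 ≤ q) (a b : ℕ) : (0 : ℝ) < (q : ℝ) ^ (a * b) := by
  have : (0 : ℝ) < q := by exact_mod_cast hq
  positivity

end Formats

/-! ## §2 Weighted products over the six patterns -/

section Products

variable (q : ℕ)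

/-- Off the pattern `(1,1,0)` the first format is `1`. [folklore] -/
theorem formatA_eq_one {s : Fin 3 × Fin 3 × Fin 3} (hs : s ∈ cwSupport₃) (hne : s ≠ (1, 1, 0)) :
    ((q : ℝ) ^ (s.1.val * s.2.1.val)) = 1 := by
  rcases mem_cwSupport₃_iff.1 hs with rfl | rfl | rfl | rfl | rfl | rfl <;> simp_all

/-- Off the pattern `(0,1,1)` the second format is `1`. [folklore] -/
theorem formatB_eq_one {s : Fin 3 × Fin 3 × Fin 3} (hs : s ∈ cwSupport₃) (hne : s ≠ (0, 1, 1)) :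
    ((q : ℝ) ^ (s.2.1.val * s.2.2.val)) = 1 := by
  rcases mem_cwSupport₃_iff.1 hs with rfl | rfl | rfl | rfl | rfl | rfl <;> simp_all

/-- Off the pattern `(1,0,1)` the third format is `1`. [folklore] -/
theorem formatC_eq_one {s : Fin 3 × Fin 3 × Fin 3} (hs : s ∈ cwSupport₃) (hne : s ≠ (1, 0, 1)) :
    ((q : ℝ) ^ (s.1.val * s.2.2.val)) = 1 := by
  rcases mem_cwSupport₃_iff.1 hs with rfl | rfl | rfl | rfl | rfl | rfl <;> simp_all

/-- `(1,1,0)` is a pattern of `CW_q`. [folklore] -/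
theorem mem_cwSupport₃_110 : ((1 : Fin 3), (1 : Fin 3), (0 : Fin 3)) ∈ cwSupport₃ :=
  mem_cwSupport₃_iff.2 (Or.inr (Or.inr (Or.inl rfl)))

/-- `(0,1,1)` is a pattern of `CW_q`. [folklore] -/
theorem mem_cwSupport₃_011 : ((0 : Fin 3), (1 : Fin 3), (1 : Fin 3)) ∈ cwSupport₃ :=
  mem_cwSupport₃_iff.2 (Or.inl rfl)

/-- `(1,0,1)` is a pattern of `CW_q`. [folklore] -/
theorem mem_cwSupport₃_101 : ((1 : Fin 3), (0 : Fin 3), (1 : Fin 3)) ∈ cwSupport₃ :=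
  mem_cwSupport₃_iff.2 (Or.inr (Or.inl rfl))

/-- **`Π_S fA^P = q^{P(1,1,0)}`.** [cite: CoppersmithWinograd1990, §6] -/
theorem prod_six_formatA (P : Fin 3 × Fin 3 × Fin 3 → ℝ) :
    ∏ s ∈ cwSupport₃, ((q : ℝ) ^ (s.1.val * s.2.1.val)) ^ P s = (q : ℝ) ^ P (1, 1, 0) := by
  rw [Finset.prod_eq_single_of_mem ((1 : Fin 3), (1 : Fin 3), (0 : Fin 3)) mem_cwSupport₃_110
    fun s hs hne => by rw [formatA_eq_one q hs hne, Real.one_rpow]]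
  simp

/-- **`Π_S fB^P = q^{P(0,1,1)}`.** [cite: CoppersmithWinograd1990, §6] -/
theorem prod_six_formatB (P : Fin 3 × Fin 3 × Fin 3 → ℝ) :
    ∏ s ∈ cwSupport₃, ((q : ℝ) ^ (s.2.1.val * s.2.2.val)) ^ P s = (q : ℝ) ^ P (0, 1, 1) := by
  rw [Finset.prod_eq_single_of_mem ((0 : Fin 3), (1 : Fin 3), (1 : Fin 3)) mem_cwSupport₃_011
    fun s hs hne => by rw [formatB_eq_one q hs hne, Real.one_rpow]]
  simp

/-- **`Π_S fC^P = q^{P(1,0,1)}`.** [cite: CoppersmithWinograd1990, §6] -/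
theorem prod_six_formatC (P : Fin 3 × Fin 3 × Fin 3 → ℝ) :
    ∏ s ∈ cwSupport₃, ((q : ℝ) ^ (s.1.val * s.2.2.val)) ^ P s = (q : ℝ) ^ P (1, 0, 1) := by
  rw [Finset.prod_eq_single_of_mem ((1 : Fin 3), (0 : Fin 3), (1 : Fin 3)) mem_cwSupport₃_101
    fun s hs hne => by rw [formatC_eq_one q hs hne, Real.one_rpow]]
  simp

/-- `Π_S 1^P = 1` (the level-1 components are single matrix products: value `1` each). [folklore] -/
theorem prod_six_one (S : Finset (Fin 3 × Fin 3 × Fin 3)) (P : Fin 3 × Fin 3 × Fin 3 → ℝ) :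
    ∏ s ∈ S, (fun _ => (1 : ℝ)) s ^ P s = 1 :=
  Finset.prod_eq_one fun _ _ => Real.one_rpow _

end Products

/-! ## §3 Positive six-pattern laws are of product form -/

section ProductForm

/-- `√a · √b = c` when `a b = c²`, `c ≥ 0`. [folklore] -/
theorem sqrt_mul_sqrt_eq {a b c : ℝ} (ha : 0 ≤ a) (hc : 0 ≤ c) (h : a * b = c * c) :
    Real.sqrt a * Real.sqrt b = c := by
  rw [← Real.sqrt_mul ha, h, Real.sqrt_mul_self hc]

/-- **Every law positive on the six patterns is of product form there**:
`P(i,j,l) = f(i) g(j) h(l)` on `{i+j+l = 2}` with `f = (1, √(p₁p₃/p₂), p₄)`,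
`g = (1, √(p₁p₂/p₃), p₅)`, `h = (1, √(p₂p₃/p₁), p₆)` — so its penalty vanishes and, pooled with
another such law, the pair penalty vanishes (`maxEntropyPenalty_pairLaw_eq_zero_of_mul`).
[cite: LeGall2014, App. A (the Lagrange form of the entropy maximiser)] -/
theorem six_productForm {P : Fin 3 × Fin 3 × Fin 3 → ℝ} {p₁ p₂ p₃ p₄ p₅ p₆ : ℝ}
    (hP : ∀ s, P s = if s = (1, 1, 0) then p₁ else if s = (0, 1, 1) then p₂
      else if s = (1, 0, 1) then p₃ else if s = (2, 0, 0) then p₄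
      else if s = (0, 2, 0) then p₅ else if s = (0, 0, 2) then p₆ else 0)
    (h₁ : 0 < p₁) (h₂ : 0 < p₂) (h₃ : 0 < p₃) (h₄ : 0 < p₄) (h₅ : 0 < p₅) (h₆ : 0 < p₆) :
    ∃ f g h : Fin 3 → ℝ, (∀ x ∈ cwSupport₃, 0 < f x.1) ∧ (∀ x ∈ cwSupport₃, 0 < g x.2.1) ∧
      (∀ x ∈ cwSupport₃, 0 < h x.2.2) ∧ ∀ x ∈ cwSupport₃, P x = f x.1 * g x.2.1 * h x.2.2 := by
  refine ⟨![1, Real.sqrt (p₁ * p₃ / p₂), p₄], ![1, Real.sqrt (p₁ * p₂ / p₃), p₅],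
    ![1, Real.sqrt (p₂ * p₃ / p₁), p₆], fun x _ => ?_, fun x _ => ?_, fun x _ => ?_, ?_⟩
  · have : 0 < Real.sqrt (p₁ * p₃ / p₂) := Real.sqrt_pos.2 (by positivity)
    fin_cases x <;> simp <;> positivity
  · have : 0 < Real.sqrt (p₁ * p₂ / p₃) := Real.sqrt_pos.2 (by positivity)
    fin_cases x <;> simp <;> positivity
  · have : 0 < Real.sqrt (p₂ * p₃ / p₁) := Real.sqrt_pos.2 (by positivity)
    fin_cases x <;> simp <;> positivity
  · intro x hx
    have e₁ : Real.sqrt (p₁ * p₃ / p₂) * Real.sqrt (p₁ * p₂ / p₃) = p₁ :=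
      sqrt_mul_sqrt_eq (by positivity) h₁.le (by field_simp)
    have e₂ : Real.sqrt (p₁ * p₂ / p₃) * Real.sqrt (p₂ * p₃ / p₁) = p₂ :=
      sqrt_mul_sqrt_eq (by positivity) h₂.le (by field_simp)
    have e₃ : Real.sqrt (p₁ * p₃ / p₂) * Real.sqrt (p₂ * p₃ / p₁) = p₃ :=
      sqrt_mul_sqrt_eq (by positivity) h₃.le (by field_simp)
    rcases mem_cwSupport₃_iff.1 hx with rfl | rfl | rfl | rfl | rfl | rfl <;>
      simp only [Matrix.cons_val_zero, Matrix.cons_val_one, Matrix.cons_val_two, Matrix.head_cons,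
        Matrix.tail_cons, one_mul, mul_one]
    · rw [e₂, hP]; simp
    · rw [e₃, hP]; simp
    · rw [e₁, hP]; simp
    · rw [hP]; simp
    · rw [hP]; simp
    · rw [hP]; simp

end ProductForm

/-! ## §4 Marginal entropies of a law with counts -/

section Counts

/-- **The marginal entropies of the law with counts `(n₁,…,n₆)/N₀` are the entropies of the
count vectors** `X = (n₂+n₅+n₆, n₁+n₃, n₄)`, `Y = (n₃+n₄+n₆, n₁+n₂, n₅)`,
`Z = (n₁+n₄+n₅, n₂+n₃, n₆)` over `N₀`. [cite: CoppersmithWinograd1990, §6] -/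
theorem shannonEntropy_marginals_six_counts {P : Fin 3 × Fin 3 × Fin 3 → ℝ}
    {n₁ n₂ n₃ n₄ n₅ n₆ N₀ : ℕ}
    (hP : ∀ s, P s = if s = (1, 1, 0) then (n₁ : ℝ) / N₀ else if s = (0, 1, 1) then (n₂ : ℝ) / N₀
      else if s = (1, 0, 1) then (n₃ : ℝ) / N₀ else if s = (2, 0, 0) then (n₄ : ℝ) / N₀
      else if s = (0, 2, 0) then (n₅ : ℝ) / N₀ else if s = (0, 0, 2) then (n₆ : ℝ) / N₀ else 0) :
    shannonEntropy (marginalDist₁ P) =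
        shannonEntropy ![((n₂ + n₅ + n₆ : ℕ) : ℝ) / N₀, ((n₁ + n₃ : ℕ) : ℝ) / N₀, (n₄ : ℝ) / N₀] ∧
      shannonEntropy (marginalDist₂ P) =
        shannonEntropy ![((n₃ + n₄ + n₆ : ℕ) : ℝ) / N₀, ((n₁ + n₂ : ℕ) : ℝ) / N₀, (n₅ : ℝ) / N₀] ∧
      shannonEntropy (marginalDist₃ P) =
        shannonEntropy ![((n₁ + n₄ + n₅ : ℕ) : ℝ) / N₀, ((n₂ + n₃ : ℕ) : ℝ) / N₀, (n₆ : ℝ) / N₀] := by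
  obtain ⟨hX, hY, hZ⟩ := marginalDist_six hP
  refine ⟨?_, ?_, ?_⟩
  · rw [hX]; push_cast; ring_nf
  · rw [hY]; push_cast; ring_nf
  · rw [hZ]; push_cast; ring_nf

/-- The law with counts vanishes off the support and is the rational law `c/N₀` of the count
function `c = (n₁,…,n₆ on the six patterns, 0 elsewhere)`, whose total is `N₀`.
[cite: CoppersmithWinograd1990, §6] -/
theorem six_counts_law {P : Fin 3 × Fin 3 × Fin 3 → ℝ} {n₁ n₂ n₃ n₄ n₅ n₆ N₀ : ℕ}
    (hN : n₁ + n₂ + n₃ + n₄ + n₅ + n₆ = N₀)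
    (hP : ∀ s, P s = if s = (1, 1, 0) then (n₁ : ℝ) / N₀ else if s = (0, 1, 1) then (n₂ : ℝ) / N₀
      else if s = (1, 0, 1) then (n₃ : ℝ) / N₀ else if s = (2, 0, 0) then (n₄ : ℝ) / N₀
      else if s = (0, 2, 0) then (n₅ : ℝ) / N₀ else if s = (0, 0, 2) then (n₆ : ℝ) / N₀ else 0)
    (c : Fin 3 × Fin 3 × Fin 3 → ℕ)
    (hc : ∀ s, c s = if s = (1, 1, 0) then n₁ else if s = (0, 1, 1) then n₂
      else if s = (1, 0, 1) then n₃ else if s = (2, 0, 0) then n₄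
      else if s = (0, 2, 0) then n₅ else if s = (0, 0, 2) then n₆ else 0) :
    (∀ s, s ∉ cwSupport₃ → c s = 0) ∧ (∑ s, c s = N₀) ∧ ∀ s, P s = (c s : ℝ) / N₀ := by
  refine ⟨fun s hs => ?_, ?_, fun s => ?_⟩
  · rw [mem_cwSupport₃_iff] at hs
    push Not at hs
    rw [hc]
    simp [hs.1, hs.2.1, hs.2.2.1, hs.2.2.2.1, hs.2.2.2.2.1, hs.2.2.2.2.2]
  · rw [← hN]
    simp only [hc, Fintype.sum_prod_type, Fin.sum_univ_three]
    simp
    ring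
  · rw [hP, hc]
    split_ifs <;> simp

end Counts

end Summit.MatrixMultiplication.MatrixMultiplication.Theorems.SaturationLadderPooled
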